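import Summits.FinalStateConjecture.FinalStateConjecture.Theorems.PhaseMixingCaptureBulkKerrCaptureC2ReflectionKerrSchild
import Literature.Geometry.Lorentzian.LateChartDilation
import HarnessLib

/-!
# Crux `PhaseMixingCapture.BulkKerrCaptureC2` (stmt-FinalStateConjecture-14985): SPIN REVERSAL — `Cᵏ`-convergence to
# `g_{M,a}` and to `g_{M,−a}` are the same property of a spacetime region

Support file for the crux `BulkKerrCaptureC2`, sequel of `…ReflectionKerrSchild`.  The consequence-form convergence
notion `Spacetime.ConvergesToKerr 𝒟 M a k` of `KerrConvergence.lean` asks for a late-time chart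
`Ψ : Kerr.exterior M a → 𝓜` in which the `Cᵏ` sup norms over the slabs `{t* = τ}` of `Ψ^* g − g_{M,a}` tend to `0`.
Precomposing `Ψ` with the coordinate reflection `L : Kerr.exterior M (−a) → Kerr.exterior M a`, `x₂ ↦ −x₂` — an
isometry `g_{M,−a} = L^* g_{M,a}` fixing `t*` (`…ReflectionKerrSchild.bilin_reflect`) — gives a late-time chart modelled
on `Kerr.exterior M (−a)` with the SAME slab deviations, so:

* §0 maps between chart domains of a normed space which are a linear isometry `L` in coordinates (`contMDiff_isom`,
  `mfderiv_isom_apply`, `injective_mfderiv_isom`);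
* §1 late-time charts under a Euclidean linear isometry `L` of the reference chart `ℝ⁴` intertwining two reference
  backgrounds `B'`, `B` (`y ∈ U' ↔ L y ∈ U`, `g₀'(y) = g₀(L y)(L ·, L ·)`, `t(L y) = t'(y)`): `deviation_comp_isom`
  (`((Ψ ∘ L)^* g − g₀')(x) = (Ψ^* g − g₀)(L x)(L ·, L ·)`), `norm_iteratedFDeriv_deviationExtend_comp_isom` (the
  iterated derivatives have the same norms: `LinearIsometryEquiv.norm_iteratedFDeriv_comp_left/right` with the
  isometry `A ↦ A(L ·, L ·)` of `…ReflectionKerrSchild.exists_bilinearCompIsometry`), **`deviationCk_comp_isom`**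
  (equal `Cᵏ` slab deviations), `isLateEmbedding_comp_isom`, `convergesTo_comp_isom`;
* §2 **`convergesToKerr_neg`** / `convergesToKerr_neg_iff`: `ConvergesToKerr 𝒟 M (−a) k ↔ ConvergesToKerr 𝒟 M a k`.

In particular the conclusion of the crux cannot see the sign of the final spin `a'` through its convergence clause —
only through the parameter clause `|M' − M| + |a' − a| ≤ η`; this is what makes the block `CaptureC2At` reflection
covariant (`…ReflectionCapture`).  Everything is proved; no definitions, no named facts.  References: M. Dafermos,
G. Holzegel, I. Rodnianski, M. Taylor, arXiv:2104.08222, §1 (the notion); R. P. Kerr, A. Schild (1965), §2; B. O'Neill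
(1995), Ch. 2, §2.1 (`a ↦ −a` reverses the sense of rotation).
-/

-- the doubled `FinalStateConjecture.FinalStateConjecture` path component trips dupNamespace
set_option linter.dupNamespace false

noncomputable section

-- instance search through the nested operator type `E4 →L[ℝ] E4 →L[ℝ] ℝ` (as in the tree files)
set_option maxSynthPendingDepth 3

open Set Function Filter Topology TopologicalSpace
open scoped Manifold ContDiff Topology ENNReal
open Literature.Geometry.Lorentzian

universe u

namespace Summit.FinalStateConjecture.FinalStateConjecture.Theorems.BulkKerrCaptureC2.Reflection

/-! ## §0 Maps between chart domains which are a linear isometry in coordinates -/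

section Generic

variable {E : Type*} [NormedAddCommGroup E] [NormedSpace ℝ E] {V V' : Opens E} {L : E ≃ₗᵢ[ℝ] E} {δ : V' → V}

/-- A map `δ : V' → V` between open subsets of a normed space which is the linear isometry `L` in coordinates is
`Cⁿ` for every `n`. [folklore] -/
theorem contMDiff_isom (hδ : ∀ x, (δ x : E) = L x) {n : ℕ∞ω} : ContMDiff 𝓘(ℝ, E) 𝓘(ℝ, E) n δ := by
  have h : ContMDiff 𝓘(ℝ, E) 𝓘(ℝ, E) n (Subtype.val ∘ δ) := by
    rw [show Subtype.val ∘ δ = fun x : V' ↦ L (x : E) from funext hδ]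
    exact (L.toContinuousLinearEquiv : E →L[ℝ] E).contDiff.contMDiff.comp contMDiff_subtype_val
  exact fun y ↦ (ChartedSpace.liftPropWithinAt_subtypeVal_comp_iff δ Set.univ y).mp (h y)

/-- Its differential is `L`. [folklore] -/
theorem mfderiv_isom_apply (hδ : ∀ x, (δ x : E) = L x) (x : V') (v : TangentSpace 𝓘(ℝ, E) x) :
    mfderiv 𝓘(ℝ, E) 𝓘(ℝ, E) δ x v = L v := by
  rw [OpensChart.mfderiv_apply_of_repr (f := δ) (Φ := fun y : E ↦ L y) hδ
    ((L.toContinuousLinearEquiv : E →L[ℝ] E).differentiableAt)]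
  exact congrFun (congrArg DFunLike.coe ((L.toContinuousLinearEquiv : E →L[ℝ] E).fderiv)) v

/-- … so its differential is injective at every point. [folklore] -/
theorem injective_mfderiv_isom (hδ : ∀ x, (δ x : E) = L x) (x : V') :
    Injective (mfderiv 𝓘(ℝ, E) 𝓘(ℝ, E) δ x) := fun v w h ↦
  L.injective (by rwa [mfderiv_isom_apply hδ x v, mfderiv_isom_apply hδ x w] at h)

end Generic

/-! ## §1 Late-time charts precomposed with a linear isometry of the reference chart -/

section Isom

variable {B B' : ModelBackground} {L : E4 ≃ₗᵢ[ℝ] E4} {δ : B'.domain → B.domain}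

/-- It is surjective as soon as the domains correspond (`y ∈ U' ↔ L y ∈ U`). [folklore] -/
theorem surjective_isom (hδ : ∀ x, (δ x : E4) = L x) (hdom : ∀ y : E4, y ∈ B'.domain ↔ L y ∈ B.domain) :
    Surjective δ := fun y ↦
  ⟨⟨L.symm (y : E4), (hdom _).2 (by rw [L.apply_symm_apply]; exact y.2)⟩,
    Subtype.ext (by rw [hδ]; exact L.apply_symm_apply _)⟩

variable (hδ : ∀ x, (δ x : E4) = L x) (htime : ∀ y : E4, B.time (L y) = B'.time y)
include hδ htime

/-- Late regions correspond: `δ x ∈ {t > τ} ↔ x ∈ {t' > τ}`. [folklore] -/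
theorem isom_mem_lateRegion_iff (τ : ℝ) (x : B'.domain) : δ x ∈ B.lateRegion τ ↔ x ∈ B'.lateRegion τ := by
  rw [ModelBackground.mem_lateRegion, ModelBackground.mem_lateRegion, hδ, htime]

/-- Time slabs correspond: `δ x ∈ {t = τ} ↔ x ∈ {t' = τ}`. [folklore] -/
theorem isom_mem_timeSlab_iff (τ : ℝ) (x : B'.domain) : δ x ∈ B.timeSlab τ ↔ x ∈ B'.timeSlab τ := by
  rw [ModelBackground.mem_timeSlab, ModelBackground.mem_timeSlab, hδ, htime]

variable (hdom : ∀ y : E4, y ∈ B'.domain ↔ L y ∈ B.domain)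
include hdom

omit hδ in
/-- The coordinate slabs correspond under `L`: `{t = τ} ∩ U = L ({t' = τ} ∩ U')` as subsets of `ℝ⁴`. [folklore] -/
theorem image_timeSlab_eq (τ : ℝ) :
    Subtype.val '' B.timeSlab τ = L '' (Subtype.val '' B'.timeSlab τ) := by
  ext y
  simp only [mem_image, ModelBackground.mem_timeSlab, Subtype.exists, exists_and_right, exists_eq_right]
  constructor
  · rintro ⟨hy, ht⟩
    refine ⟨L.symm y, ⟨(hdom _).2 (by rw [L.apply_symm_apply]; exact hy), ?_⟩, L.apply_symm_apply y⟩
    rw [← htime, L.apply_symm_apply]; exact ht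
  · rintro ⟨z, ⟨hz, ht⟩, rfl⟩
    exact ⟨(hdom z).1 hz, by rw [htime]; exact ht⟩

variable {𝓢 : Spacetime.{u} 4} (hbil : ∀ y v w : E4, B'.bilin y v w = B.bilin (L y) (L v) (L w))
include hbil

omit htime hdom in
/-- **The deviation of `Ψ ∘ δ` from `B'` is the deviation of `Ψ` from `B` read through `L`**:
`((Ψ ∘ δ)^* g − g₀')(x)(v, w) = (Ψ^* g − g₀)(δ x)(L v, L w)` (chain rule, `dδ = L`, and `g₀' = g₀(L ·)(L ·, L ·)`).
DHRT arXiv:2104.08222, §1 (the notion). [cite: arXiv210408222, §1] -/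
theorem deviation_comp_isom {Ψ : B.domain → 𝓢.carrier} (hΨ : ContMDiff 𝓘(ℝ, E4) (𝓡 4) ∞ Ψ)
    (x : B'.domain) (v w : E4) :
    𝓢.deviation B' (Ψ ∘ δ) x v w = 𝓢.deviation B Ψ (δ x) (L v) (L w) := by
  have hδd : MDifferentiableAt 𝓘(ℝ, E4) 𝓘(ℝ, E4) δ x := (contMDiff_isom hδ (n := 1)).mdifferentiableAt one_ne_zero
  have hΨd : MDifferentiableAt 𝓘(ℝ, E4) (𝓡 4) Ψ (δ x) := hΨ.mdifferentiableAt (by simp)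
  have hcomp : ∀ v : TangentSpace 𝓘(ℝ, E4) (δ x), mfderiv 𝓘(ℝ, E4) (𝓡 4) (Ψ ∘ δ) x v =
      mfderiv 𝓘(ℝ, E4) (𝓡 4) Ψ (δ x) (L v) := fun v ↦ by
    rw [mfderiv_comp x hΨd hδd]
    show mfderiv 𝓘(ℝ, E4) (𝓡 4) Ψ (δ x) (mfderiv 𝓘(ℝ, E4) 𝓘(ℝ, E4) δ x v) = _
    rw [mfderiv_isom_apply hδ x v]
  rw [Spacetime.deviation_apply, Spacetime.deviation_apply, hcomp v, hcomp w, hbil, ← hδ]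
  rfl

omit htime in
/-- The junk-extended deviations correspond: `deviationExtend (g, B') (Ψ ∘ δ) = Φ ∘ deviationExtend (g, B) Ψ ∘ L` for
the isometry `Φ A = A(L ·, L ·)` of bilinear forms (on `U'` by `deviation_comp_isom`, off `U'` both vanish).
[cite: arXiv210408222, §1] -/
theorem deviationExtend_comp_isom {Ψ : B.domain → 𝓢.carrier} (hΨ : ContMDiff 𝓘(ℝ, E4) (𝓡 4) ∞ Ψ)
    {Φ : (E4 →L[ℝ] E4 →L[ℝ] ℝ) ≃ₗᵢ[ℝ] (E4 →L[ℝ] E4 →L[ℝ] ℝ)}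
    (hΦ : ∀ (A : E4 →L[ℝ] E4 →L[ℝ] ℝ) (v w : E4), Φ A v w = A (L v) (L w)) :
    𝓢.deviationExtend B' (Ψ ∘ δ) = Φ ∘ 𝓢.deviationExtend B Ψ ∘ L := by
  funext y
  by_cases hy : y ∈ B'.domain
  · obtain ⟨x, rfl⟩ : ∃ x : B'.domain, (x : E4) = y := ⟨⟨y, hy⟩, rfl⟩
    rw [Spacetime.deviationExtend_coe, comp_apply, comp_apply, ← hδ, Spacetime.deviationExtend_coe]
    refine ContinuousLinearMap.ext fun v ↦ ContinuousLinearMap.ext fun w ↦ ?_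
    rw [hΦ, deviation_comp_isom hδ hbil hΨ]
  · rw [𝓢.deviationExtend_of_not_mem B' _ hy, comp_apply, comp_apply,
      𝓢.deviationExtend_of_not_mem B _ (mt (hdom y).2 hy), LinearIsometryEquiv.map_zero]

omit htime in
/-- **The iterated derivatives of the two junk-extended deviations have equal norms**:
`‖Dᵐ deviationExtend (g, B') (Ψ ∘ δ) (y)‖ = ‖Dᵐ deviationExtend (g, B) Ψ (L y)‖` (composition with linear isometric
equivalences on both sides; no differentiability needed). [cite: arXiv210408222, §1] -/
theorem norm_iteratedFDeriv_deviationExtend_comp_isom {Ψ : B.domain → 𝓢.carrier}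
    (hΨ : ContMDiff 𝓘(ℝ, E4) (𝓡 4) ∞ Ψ) (m : ℕ) (y : E4) :
    ‖iteratedFDeriv ℝ m (𝓢.deviationExtend B' (Ψ ∘ δ)) y‖ =
      ‖iteratedFDeriv ℝ m (𝓢.deviationExtend B Ψ) (L y)‖ := by
  obtain ⟨Φ, hΦ⟩ := exists_bilinearCompIsometry (F := E4) L
  rw [deviationExtend_comp_isom hδ hdom hbil hΨ hΦ, Φ.norm_iteratedFDeriv_comp_left,
    L.norm_iteratedFDeriv_comp_right]

/-- **Equal `Cᵏ` slab deviations**: `deviationCk (g, B') (Ψ ∘ δ) k τ = deviationCk (g, B) Ψ k τ` (the slabs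
correspond under `L`, `image_timeSlab_eq`, and the pointwise norms agree). [cite: arXiv210408222, §1] -/
theorem deviationCk_comp_isom {Ψ : B.domain → 𝓢.carrier} (hΨ : ContMDiff 𝓘(ℝ, E4) (𝓡 4) ∞ Ψ) (k : ℕ) (τ : ℝ) :
    𝓢.deviationCk B' (Ψ ∘ δ) k τ = 𝓢.deviationCk B Ψ k τ := by
  unfold Spacetime.deviationCk supCkENorm
  rw [image_timeSlab_eq htime hdom τ]
  refine iSup_congr fun m ↦ iSup_congr fun _ ↦ ?_
  rw [iSup_image (f := (L : E4 → E4)) (g := fun x ↦ ‖iteratedFDeriv ℝ m (𝓢.deviationExtend B Ψ) x‖ₑ)]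
  refine iSup_congr fun y ↦ iSup_congr fun _ ↦ ?_
  rw [← ofReal_norm, ← ofReal_norm, norm_iteratedFDeriv_deviationExtend_comp_isom hδ hdom hbil hΨ]

/-- Decay of the slab deviations transfers. [cite: arXiv210408222, §1] -/
theorem tendsto_deviationCk_comp_isom {Ψ : B.domain → 𝓢.carrier} (hΨ : ContMDiff 𝓘(ℝ, E4) (𝓡 4) ∞ Ψ) {k : ℕ}
    (h : Tendsto (fun τ ↦ 𝓢.deviationCk B Ψ k τ) atTop (𝓝 0)) :
    Tendsto (fun τ ↦ 𝓢.deviationCk B' (Ψ ∘ δ) k τ) atTop (𝓝 0) := by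
  simp_rw [deviationCk_comp_isom hδ htime hdom hbil hΨ]
  exact h

omit hbil in
/-- **A late-time chart precomposed with the isometry is a late-time chart** (after the same time `τ₀`): `δ` is
smooth, restricts to a homeomorphism `{t' > τ₀} ≃ {t > τ₀}`, and the images of the late regions coincide.
DHRT arXiv:2104.08222, §1 (the notion). [cite: arXiv210408222, §1] -/
theorem isLateChart_comp_isom {O : Set 𝓢.carrier} {τ₀ : ℝ} {Ψ : B.domain → 𝓢.carrier}
    (hΨ : 𝓢.IsLateChart B O τ₀ Ψ) : 𝓢.IsLateChart B' O τ₀ (Ψ ∘ δ) := by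
  have hcont : Continuous δ := (contMDiff_isom hδ (n := 0)).continuous
  have hmem : ∀ w : B.lateRegion τ₀, L.symm ((w : B.domain) : E4) ∈ B'.domain := fun w ↦
    (hdom _).2 (by rw [L.apply_symm_apply]; exact w.1.2)
  have hlate : ∀ w : B.lateRegion τ₀, (⟨L.symm ((w : B.domain) : E4), hmem w⟩ : B'.domain) ∈ B'.lateRegion τ₀ :=
    fun w ↦ by
    have hw : τ₀ < B.time ((w : B.domain) : E4) := w.2
    rw [ModelBackground.mem_lateRegion]
    change τ₀ < B'.time (L.symm ((w : B.domain) : E4))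
    rwa [← htime, L.apply_symm_apply]
  have hlate' : ∀ z : B'.lateRegion τ₀, δ z.1 ∈ B.lateRegion τ₀ := fun z ↦
    (isom_mem_lateRegion_iff hδ htime τ₀ z.1).2 z.2
  let e : B'.lateRegion τ₀ ≃ₜ B.lateRegion τ₀ :=
    { toFun := fun z ↦ ⟨δ z.1, hlate' z⟩
      invFun := fun w ↦ ⟨⟨L.symm ((w : B.domain) : E4), hmem w⟩, hlate w⟩
      left_inv := fun z ↦ Subtype.ext (Subtype.ext (by
        change L.symm ((δ z.1 : B.domain) : E4) = _
        rw [hδ, L.symm_apply_apply]))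
      right_inv := fun w ↦ Subtype.ext (Subtype.ext (by
        change ((δ _ : B.domain) : E4) = _
        rw [hδ]
        exact L.apply_symm_apply _))
      continuous_toFun := (hcont.comp continuous_subtype_val).subtype_mk _
      continuous_invFun := ((L.symm.continuous.comp
        (continuous_subtype_val.comp continuous_subtype_val)).subtype_mk _).subtype_mk _ }
  refine ⟨hΨ.contMDiff.comp (contMDiff_isom hδ), ?_, ?_⟩
  · have hfac : (B'.lateRegion τ₀).restrict (Ψ ∘ δ) = (B.lateRegion τ₀).restrict Ψ ∘ e := rfl
    rw [hfac]
    exact hΨ.isOpenEmbedding.comp e.isOpenEmbedding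
  · rintro _ ⟨x, hx, rfl⟩
    exact hΨ.image_subset ⟨δ x, hlate' ⟨x, hx⟩, rfl⟩

omit hbil in
/-- **A late-time embedding precomposed with the isometry is a late-time embedding**: the images of the late region
and of the initial slab are unchanged (`δ` is onto and intertwines them), so the covering condition is literally the
same. DHRT arXiv:2104.08222, §1 (the notion). [cite: arXiv210408222, §1] -/
theorem isLateEmbedding_comp_isom {O : Set 𝓢.carrier} {τ₀ : ℝ} {Ψ : B.domain → 𝓢.carrier}
    (hΨ : 𝓢.IsLateEmbedding B O τ₀ Ψ) : 𝓢.IsLateEmbedding B' O τ₀ (Ψ ∘ δ) := by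
  have hsurj : Surjective δ := surjective_isom hδ hdom
  have h1 : (Ψ ∘ δ) '' B'.lateRegion τ₀ = Ψ '' B.lateRegion τ₀ :=
    image_comp_dilate Ψ hsurj fun x ↦ isom_mem_lateRegion_iff hδ htime τ₀ x
  have h2 : (Ψ ∘ δ) '' B'.timeSlab τ₀ = Ψ '' B.timeSlab τ₀ :=
    image_comp_dilate Ψ hsurj fun x ↦ isom_mem_timeSlab_iff hδ htime τ₀ x
  refine ⟨isLateChart_comp_isom hδ htime hdom hΨ.toIsLateChart, ?_⟩
  rw [h1, h2]
  exact hΨ.diff_subset_causalPast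

/-- **`Cᵏ`-convergence to a background transfers to the isometric background**: if `(𝓜, g)` has a region `O`
converging in `Cᵏ` to `B`, then `O` converges in `Cᵏ` to `B'` (same time `τ₀`, chart `Ψ ∘ δ`).
DHRT arXiv:2104.08222, §1. [cite: arXiv210408222, §1] -/
theorem convergesTo_comp_isom {O : Set 𝓢.carrier} {k : ℕ} (h : 𝓢.ConvergesTo B O k) : 𝓢.ConvergesTo B' O k := by
  obtain ⟨τ₀, Ψ, hΨ, ht⟩ := h
  exact ⟨τ₀, Ψ ∘ δ, isLateEmbedding_comp_isom hδ htime hdom hΨ,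
    tendsto_deviationCk_comp_isom hδ htime hdom hbil hΨ.contMDiff ht⟩

end Isom

/-! ## §2 `Cᵏ`-convergence to `g_{M,a}` versus to `g_{M,−a}` -/

/-- **`Cᵏ`-convergence to Kerr does not see the sign of the spin**: a region converging in `Cᵏ` to `g_{M,a}`
converges in `Cᵏ` to `g_{M,−a}` — precompose the late-time chart `Ψ : Kerr.exterior M a → 𝓜` with the reflection
`x₂ ↦ −x₂`, `Kerr.exterior M (−a) → Kerr.exterior M a`, an isometry `g_{M,−a} = L^* g_{M,a}` fixing `t*`
(`bilin_reflect`, `reflect_mem_exterior_iff`).  Kerr–Schild 1965, §2; O'Neill 1995, Ch. 2, §2.1; DHRT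
arXiv:2104.08222, §1. [cite: KerrSchild1965, §2] -/
theorem convergesToKerr_neg (𝓢 : Spacetime.{u} 4) {O : Set 𝓢.carrier} {M a : ℝ} {k : ℕ}
    (h : 𝓢.ConvergesToKerr O M a k) : 𝓢.ConvergesToKerr O M (-a) k := by
  obtain ⟨L, -, hL, -⟩ := exists_reflections
  have hdom : ∀ y : E4, y ∈ (Kerr.background M (-a)).domain ↔ L y ∈ (Kerr.background M a).domain := fun y ↦
    (reflect_mem_exterior_iff hL).symm
  let δ : (Kerr.background M (-a)).domain → (Kerr.background M a).domain := fun y ↦ ⟨L (y : E4), (hdom y).1 y.2⟩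
  have hδ : ∀ x, (δ x : E4) = L (x : E4) := fun _ ↦ rfl
  have hbil : ∀ y v w : E4, (Kerr.background M (-a)).bilin y v w = (Kerr.background M a).bilin (L y) (L v) (L w) :=
    fun y v w ↦ bilin_reflect hL M a y v w
  have htime : ∀ y : E4, (Kerr.background M a).time (L y) = (Kerr.background M (-a)).time y := fun y ↦
    reflect_apply_zero hL y
  exact convergesTo_comp_isom hδ htime hdom hbil h

/-- **`ConvergesToKerr 𝒟 M (−a) k ↔ ConvergesToKerr 𝒟 M a k`** (`convergesToKerr_neg` both ways). So the conclusion
of the crux `BulkKerrCaptureC2` constrains the sign of the final spin `a'` only through its parameter clause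
`|M' − M| + |a' − a| ≤ η`, never through the convergence clause. [cite: KerrSchild1965, §2] -/
theorem convergesToKerr_neg_iff (𝓢 : Spacetime.{u} 4) {O : Set 𝓢.carrier} {M a : ℝ} {k : ℕ} :
    𝓢.ConvergesToKerr O M (-a) k ↔ 𝓢.ConvergesToKerr O M a k :=
  ⟨fun h ↦ by simpa using convergesToKerr_neg 𝓢 h, fun h ↦ convergesToKerr_neg 𝓢 h⟩

/-- **Registered sub-goal `stub_convergesToKerr_neg_iff`** (crux item stmt-FinalStateConjecture-14985): `Cᵏ`-convergence
of a spacetime region to `g_{M,−a}` and to `g_{M,a}` are equivalent (closed form of `convergesToKerr_neg_iff`).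
[cite: KerrSchild1965, §2] -/
theorem stub_convergesToKerr_neg_iff : ∀ (𝓢 : Spacetime.{0} 4) (O : Set 𝓢.carrier) (M a : ℝ) (k : ℕ), 𝓢.ConvergesToKerr O M (-a) k ↔ 𝓢.ConvergesToKerr O M a k :=
  fun 𝓢 _ _ _ _ ↦ convergesToKerr_neg_iff 𝓢

end Summit.FinalStateConjecture.FinalStateConjecture.Theorems.BulkKerrCaptureC2.Reflection

end
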